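import Literature.AlgebraicGeometry.Resolution.LogRegularAtlasComparison
import Literature.AlgebraicGeometry.Resolution.LogRegularResolutionGeneral
import HarnessLib

/-!
# Translating a log regular Zariski atlas by automorphisms
# (the chart bookkeeping of equivariant Kato 1994 (10.4))

Topic: `Literature/AlgebraicGeometry/Resolution`. For a finite group `G` acting on a scheme `X`
by automorphisms that respect a log regular Zariski fs atlas (Kato 1994 (1.5)–(1.6), Def. (2.1);
`LogAtlas.IsLogEquivariant`, `LogRegularEquivariantResolution.lean`), the pulled-back charts
`(ρ g)^* φ_i : P_i → Γ(X, (ρ g)⁻¹ U_i)` are again charts of the SAME log structure. This file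
provides the bookkeeping that turns the `G`-translates of the charts into ordinary members of ONE
`LogRegularAtlas` (`LogRegularAtlas.lean`), so that the non-equivariant resolution machinery
(`LogRegularResolutionGeneral.lean`, Kato (10.4) atlas form) can be run on all translates at once:

* `chartStalkMonoid_comp_app` — the stalk monoid of a pulled-back chart `f^* φ` at `x` is the
  image of the stalk monoid of `φ` at `f x` under the stalk isomorphism `f_x^* : 𝒪_{f x} ≅ 𝒪_x`;
* `LogChart.isLogRegularAt_comp_ringEquiv_iff` — Kato's (2.1) at a prime is invariant under ring
  isomorphisms of the chart ring;
* `LogRegularAtlas.translate` — **the translated atlas**: charts `(i, k)` with domain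
  `(σ k)⁻¹ U_i` and chart `(σ k)^* φ_i`, for a finite family `σ` of automorphisms respecting the
  stalk monoids; it is a `LogRegularAtlas` (compatibility because all stalk monoids at `x` are the
  one of any original chart at `x`);
* `Fan.FamilyLink.pushforward`, `LogRegularAtlas.translateLinks` — the links of the translated
  atlas (Kato (10.1): faces of the chart cones at common points), pushed forward to links between
  members of the ORIGINAL family of chart fans (all translates of the chart `i` have the cone
  `P_i^∨`), the link set fed to [KempfEtAl1973] II §2 Thm. 11* in `LogRegularEquivariantCharts`.
(The passage from an equivariant `LogAtlas` to such data is in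
`LogRegularEquivariantResolutionHolds.lean`.)

References: K. Kato, *Toric singularities*, Amer. J. Math. 116 (1994), (1.5)–(1.6), Def. (2.1);
L. Illusie, M. Temkin, Exp. VIII in Astérisque 363–364 (2014), 3.4.9 (functoriality of the
monoidal desingularisation, whose equivariant case this serves); W. Nizioł, J. Algebraic Geom. 15
(2006), Lemma 2.4, Thm. 5.10 (proof: invariance under cone automorphisms).
-/

noncomputable section

open AlgebraicGeometry CategoryTheory TopologicalSpace Opposite
open Literature.Geometry.PolyhedralFans

/-! ## Pushing links forward along a renaming of the members -/

namespace Literature.Geometry.PolyhedralFans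

/-- **Renaming the members of a linked family.** A link of the pulled-back family
`i' ↦ Δ (π i')` (members indexed by `ι'`, each the member `π i'` of the family `Δ`) IS a link of
the family `Δ` between the members `π i` and `π j`: same cones, same lattice isomorphism. (Declared
here, outside `Literature/Geometry/PolyhedralFans/`, as a dot-notation extension of
`Fan.FamilyLink`.) [cite: KempfEtAl1973, Ch. II §1 Def. 5] -/
def Fan.FamilyLink.pushforward {ι ι' : Type*} {n : ι → ℕ} {Δ : ∀ i, Fan ℚ (Fin (n i) → ℚ)}
    (π : ι' → ι) (ℓ : Fan.FamilyLink (fun i' => n (π i')) (fun i' => Δ (π i'))) :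
    Fan.FamilyLink n Δ where
  i := π ℓ.i
  j := π ℓ.j
  src := ℓ.src
  tgt := ℓ.tgt
  src_mem := ℓ.src_mem
  tgt_mem := ℓ.tgt_mem
  toLin := ℓ.toLin
  invLin := ℓ.invLin
  mapsTo := ℓ.mapsTo
  mapsTo_inv := ℓ.mapsTo_inv
  left_inv := ℓ.left_inv
  right_inv := ℓ.right_inv
  integral := ℓ.integral
  integral_inv := ℓ.integral_inv

end Literature.Geometry.PolyhedralFans

namespace Literature.AlgebraicGeometry.Resolution

universe u

/-! ## Stalk monoids of pulled-back charts -/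

section Transport

variable {X Y : Scheme.{u}}

/-- The units of a ring are carried ONTO the units by a ring isomorphism (as submonoids).
[folklore] -/
private theorem IsUnit.submonoid_map_of_bijective {A B : Type*} [CommRing A] [CommRing B] (e : A →+* B)
    (he : Function.Bijective e) :
    (IsUnit.submonoid A).map e.toMonoidHom = IsUnit.submonoid B := by
  apply le_antisymm
  · rintro _ ⟨a, ha, rfl⟩
    exact (IsUnit.mem_submonoid_iff _).2 (((IsUnit.mem_submonoid_iff _).1 ha).map e)
  · intro b hb
    obtain ⟨a, rfl⟩ := he.2 b
    refine ⟨a, (IsUnit.mem_submonoid_iff _).2 ?_, rfl⟩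
    exact (isUnit_map_iff (RingEquiv.ofBijective e he) a).1 ((IsUnit.mem_submonoid_iff _).1 hb)

/-- **Stalk monoid of a pulled-back chart.** For a morphism `f : X → Y` with bijective stalk map at
`x` (e.g. an isomorphism), an open `U ⊆ Y` and a chart `φ : P → Γ(Y, U)`, the stalk monoid at `x`
of the pulled-back chart `f^* φ : P → Γ(X, f⁻¹ U)` is the image under `f_x^* : 𝒪_{Y, f x} → 𝒪_{X, x}`
of the stalk monoid of `φ` at `f x` (germs: `(f^* s)_x = f_x^* (s_{f x})`).
[cite: Kato1994, (1.5)–(1.6)] -/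
theorem chartStalkMonoid_comp_app (f : X ⟶ Y) (U : Y.Opens) {P : Type*} [MulOneClass P]
    (φ : P →* Γ(Y, U)) (x : X) (hx : f.base x ∈ U)
    (hf : Function.Bijective (f.stalkMap x).hom) :
    chartStalkMonoid (f ⁻¹ᵁ U) ((f.app U).hom.toMonoidHom.comp φ) x hx =
      (chartStalkMonoid U φ (f.base x) hx).map (f.stalkMap x).hom.toMonoidHom := by
  simp only [chartStalkMonoid, Submonoid.map_sup, MonoidHom.map_mrange]
  rw [IsUnit.submonoid_map_of_bijective _ hf]
  congr 1
  refine congrArg MonoidHom.mrange (MonoidHom.ext fun p => ?_)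
  simp only [MonoidHom.coe_comp, Function.comp_apply, RingHom.toMonoidHom_eq_coe,
    MonoidHom.coe_coe]
  exact (Scheme.Hom.germ_stalkMap_apply f U x hx (φ p)).symm

/-- For an isomorphism of schemes the stalk maps are bijective. [folklore] -/
private theorem stalkMap_bijective_of_isIso (f : X ⟶ Y) [IsIso f] (x : X) :
    Function.Bijective (f.stalkMap x).hom :=
  ConcreteCategory.bijective_of_isIso (f.stalkMap x)

end Transport


/-! ## Kato's (2.1) at a prime is invariant under isomorphisms of the chart ring -/

namespace LogChart

variable {n : ℕ} {A B : Type u} [CommRing A] [CommRing B]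

/-- **Log regularity at a prime is invariant under ring isomorphisms**: for `e : A ≃+* B`, a
chart `φ : P → A` and a prime `𝔮` of `B`, the chart `e ∘ φ` is log regular at `𝔮` iff `φ` is log
regular at `e⁻¹ 𝔮` (the local rings `A_{e⁻¹𝔮} ≅ B_𝔮` are isomorphic compatibly with the charts;
`LogChart.isLogRegularLocal_comp_equiv`). [cite: Kato1994, Def. (2.1)] -/
theorem isLogRegularAt_comp_ringEquiv_iff (P : AddSubmonoid (Fin n → ℤ))
    (φ : Multiplicative P →* A) (e : A ≃+* B) (𝔮 : Ideal B) [𝔮.IsPrime] :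
    IsLogRegularAt P (e.toMonoidHom.comp φ) 𝔮 ↔ IsLogRegularAt P φ (𝔮.comap (e : A →+* B)) := by
  set 𝔭 : Ideal A := 𝔮.comap (e : A →+* B) with h𝔭
  have hM : 𝔭.primeCompl.map e.toMonoidHom = 𝔮.primeCompl := by
    ext b
    simp only [Submonoid.mem_map]
    constructor
    · rintro ⟨a, ha, rfl⟩
      have ha' : a ∉ 𝔭 := Ideal.mem_primeCompl_iff.1 ha
      exact Ideal.mem_primeCompl_iff.2 fun hb => ha' (by rw [h𝔭, Ideal.mem_comap]; exact hb)
    · intro hb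
      have hb' : b ∉ 𝔮 := Ideal.mem_primeCompl_iff.1 hb
      refine ⟨e.symm b, Ideal.mem_primeCompl_iff.2 fun ha => hb' ?_, e.apply_symm_apply b⟩
      rw [h𝔭, Ideal.mem_comap] at ha
      simpa using ha
  let eL : Localization.AtPrime 𝔭 ≃+* Localization.AtPrime 𝔮 :=
    IsLocalization.ringEquivOfRingEquiv (Localization.AtPrime 𝔭) (Localization.AtPrime 𝔮) e hM
  rw [isLogRegularAt_iff_isLogRegularLocal, isLogRegularAt_iff_isLogRegularLocal,
    ← isLogRegularLocal_comp_equiv P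
      ((algebraMap A (Localization.AtPrime 𝔭)).toMonoidHom.comp φ) eL]
  have hcharts : eL.toMonoidHom.comp ((algebraMap A (Localization.AtPrime 𝔭)).toMonoidHom.comp φ) =
      (algebraMap B (Localization.AtPrime 𝔮)).toMonoidHom.comp (e.toMonoidHom.comp φ) := by
    refine MonoidHom.ext fun p => ?_
    simp only [MonoidHom.coe_comp, Function.comp_apply, RingHom.toMonoidHom_eq_coe,
      MonoidHom.coe_coe]
    exact IsLocalization.ringEquivOfRingEquiv_eq hM (φ p)
  rw [hcharts]

end LogChart

/-! ## The translated atlas -/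

namespace LogRegularAtlas

variable {X : Scheme.{u}} (ℬ : LogRegularAtlas X)

/-- **The stalk monoids of `ℬ` are respected by the automorphism `σ`**: for `x ∈ U_i` with
`σ x ∈ U_j`, the stalk isomorphism `σ_x^*` carries `𝒪^× · φ_j(P_j)` at `σ x` onto `𝒪^× · φ_i(P_i)`
at `x` — `σ` is an automorphism of the log structure presented by `ℬ` (Kato (1.5)–(1.6); for an
action by log automorphisms of a `LogAtlas` this is
`LogAtlas.IsLogEquivariant.map_chartStalkMonoid_eq`). [cite: Kato1994, (1.5)–(1.6)] -/
def RespectsStalkMonoids (σ : Aut X) : Prop :=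
  ∀ (x : X) (i j : ℬ.ι) (hi : x ∈ (ℬ.U i : X.Opens)) (hj : σ.hom.base x ∈ (ℬ.U j : X.Opens)),
    (chartStalkMonoid (ℬ.U j : X.Opens) (ℬ.φ j) (σ.hom.base x) hj).map
        (σ.hom.stalkMap x).hom.toMonoidHom =
      chartStalkMonoid (ℬ.U i : X.Opens) (ℬ.φ i) x hi

variable {κ : Type} (σ : κ → Aut X) (hσ : ∀ k, ℬ.RespectsStalkMonoids (σ k))

/-- The domain of the translated chart `(i, k)`: the affine open `(σ k)⁻¹ U_i`.
[cite: Kato1994, (1.5)] -/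
@[reducible] def translateU (ik : ℬ.ι × κ) : X.affineOpens :=
  ⟨(σ ik.2).hom ⁻¹ᵁ (ℬ.U ik.1 : X.Opens), (ℬ.U ik.1).2.preimage_of_isIso (σ ik.2).hom⟩

/-- The translated chart `(σ k)^* φ_i : P_i → Γ(X, (σ k)⁻¹ U_i)`. [cite: Kato1994, (1.5)] -/
@[reducible] def translateφ (ik : ℬ.ι × κ) :
    Multiplicative (ℬ.P ik.1) →* Γ(X, (ℬ.translateU σ ik : X.Opens)) :=
  ((σ ik.2).hom.app (ℬ.U ik.1 : X.Opens)).hom.toMonoidHom.comp (ℬ.φ ik.1)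

/-- Unfolding `translateφ` (`rfl`). [cite: Kato1994, (1.5)] -/
@[simp] theorem translateφ_apply (ik : ℬ.ι × κ) (p : Multiplicative (ℬ.P ik.1)) :
    ℬ.translateφ σ ik p = ((σ ik.2).hom.app (ℬ.U ik.1 : X.Opens)).hom (ℬ.φ ik.1 p) :=
  rfl

/-- The stalk monoid of the translated chart `(i, k)` at `x` is the image under `(σ k)_x^*` of the
stalk monoid of the chart `i` at `σ k x`. [cite: Kato1994, (1.5)–(1.6)] -/
theorem chartStalkMonoid_translate (ik : ℬ.ι × κ) (x : X) (hx : x ∈ (ℬ.translateU σ ik : X.Opens)) :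
    chartStalkMonoid (ℬ.translateU σ ik : X.Opens) (ℬ.translateφ σ ik) x hx =
      (chartStalkMonoid (ℬ.U ik.1 : X.Opens) (ℬ.φ ik.1) ((σ ik.2).hom.base x) hx).map
        ((σ ik.2).hom.stalkMap x).hom.toMonoidHom :=
  chartStalkMonoid_comp_app (σ ik.2).hom _ (ℬ.φ ik.1) x hx (stalkMap_bijective_of_isIso _ x)

include hσ in
/-- With automorphisms respecting the stalk monoids, the stalk monoid of every translated chart at
`x` is the stalk monoid of any original chart at `x`. [cite: Kato1994, (1.5)–(1.6)] -/
theorem chartStalkMonoid_translate_eq (ik : ℬ.ι × κ) (x : X)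
    (hx : x ∈ (ℬ.translateU σ ik : X.Opens)) (l : ℬ.ι) (hl : x ∈ (ℬ.U l : X.Opens)) :
    chartStalkMonoid (ℬ.translateU σ ik : X.Opens) (ℬ.translateφ σ ik) x hx =
      chartStalkMonoid (ℬ.U l : X.Opens) (ℬ.φ l) x hl := by
  rw [chartStalkMonoid_translate]
  exact hσ ik.2 x l ik.1 hl hx

/-- The ring of sections of a translated chart domain is isomorphic to that of the original chart
domain (`(σ k)^*` on sections). [cite: Kato1994, (1.5)] -/
def translateRingEquiv (ik : ℬ.ι × κ) :
    Γ(X, (ℬ.U ik.1 : X.Opens)) ≃+* Γ(X, (ℬ.translateU σ ik : X.Opens)) :=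
  (asIso ((σ ik.2).hom.app (ℬ.U ik.1 : X.Opens))).commRingCatIsoToRingEquiv

/-- The translated chart is the original chart followed by `translateRingEquiv`.
[cite: Kato1994, (1.5)] -/
theorem translateφ_eq (ik : ℬ.ι × κ) :
    ℬ.translateφ σ ik = (ℬ.translateRingEquiv σ ik).toMonoidHom.comp (ℬ.φ ik.1) :=
  rfl

/-- **Germs of translated chart elements**: the germ at `x` of `(σ k)^* φ_i(p)` is `(σ k)_x^*` of the
germ of `φ_i(p)` at `σ k x`. [cite: Kato1994, (1.5)–(1.6)] -/
theorem germ_translateφ (ik : ℬ.ι × κ) (x : X) (hx : x ∈ (ℬ.translateU σ ik : X.Opens))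
    (p : Multiplicative (ℬ.P ik.1)) :
    (X.presheaf.germ (ℬ.translateU σ ik : X.Opens) x hx).hom (ℬ.translateφ σ ik p) =
      ((σ ik.2).hom.stalkMap x).hom
        ((X.presheaf.germ (ℬ.U ik.1 : X.Opens) ((σ ik.2).hom.base x) hx).hom (ℬ.φ ik.1 p)) := by
  rw [translateφ_apply]
  exact (Scheme.Hom.germ_stalkMap_apply (σ ik.2).hom _ x hx (ℬ.φ ik.1 p)).symm

variable [Finite κ] [Nonempty κ]

include hσ in
/-- **The translated atlas**: the charts `(σ k)^* φ_i` on the affine opens `(σ k)⁻¹ U_i`, for a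
finite family `σ` of automorphisms respecting the stalk monoids of `ℬ`, form a log regular Zariski
fs atlas with the same monoids `P_i` — the domains cover (already for one `k`), the section rings
are Noetherian and the charts log regular at every prime (transport along `(σ k)^*`,
`LogChart.isLogRegularAt_comp_ringEquiv_iff`), and any two translated charts through `x` have the
stalk monoid of an original chart at `x` (`chartStalkMonoid_translate_eq`).
[cite: Kato1994, (1.5) and Def. (2.1)] -/
@[reducible] def translate : LogRegularAtlas X where
  ι := ℬ.ι × κ
  finite := by haveI := ℬ.finite; infer_instance
  U := ℬ.translateU σ
  iSup_eq_top := by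
    obtain ⟨k⟩ := ‹Nonempty κ›
    refine top_le_iff.mp fun x _ => ?_
    have hx : (σ k).hom.base x ∈ (⊤ : X.Opens) := trivial
    rw [← ℬ.iSup_eq_top] at hx
    obtain ⟨i, hi⟩ := Opens.mem_iSup.mp hx
    exact Opens.mem_iSup.mpr ⟨(i, k), hi⟩
  isNoetherianRing ik := by
    haveI := ℬ.isNoetherianRing ik.1
    exact isNoetherianRing_of_ringEquiv _ (ℬ.translateRingEquiv σ ik)
  n ik := ℬ.n ik.1
  P ik := ℬ.P ik.1
  fg ik := ℬ.fg ik.1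
  saturated ik := ℬ.saturated ik.1
  span_eq_top ik := ℬ.span_eq_top ik.1
  φ := ℬ.translateφ σ
  isLogRegularAt ik 𝔭 _ := by
    rw [translateφ_eq, LogChart.isLogRegularAt_comp_ringEquiv_iff]
    exact ℬ.isLogRegularAt ik.1 _
  compat ik jl x hik hjl := by
    have hx : x ∈ (⊤ : X.Opens) := trivial
    rw [← ℬ.iSup_eq_top] at hx
    obtain ⟨l, hl⟩ := Opens.mem_iSup.mp hx
    rw [ℬ.chartStalkMonoid_translate_eq σ hσ ik x hik l hl,
      ℬ.chartStalkMonoid_translate_eq σ hσ jl x hjl l hl]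

/-! ## The links of the translated atlas, on the original family of chart fans -/

/-- The link of the translated atlas at `y ∈ U_{(i,k)} ∩ U_{(j,k')}`, pushed forward to a link
between the members `i` and `j` of the family of chart fans of `ℬ` (the translated chart `(i, k)`
has the monoid `P_i`, hence the cone `σ_i`). [cite: Kato1994, (10.1)] -/
def translateLinkAt (i j : ℬ.ι × κ) (y : X) (hi : y ∈ ((ℬ.translate σ hσ).U i : X.Opens))
    (hj : y ∈ ((ℬ.translate σ hσ).U j : X.Opens)) : Fan.FamilyLink ℬ.n ℬ.chartFan :=
  Fan.FamilyLink.pushforward (n := ℬ.n) (Δ := ℬ.chartFan) Prod.fst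
    ((ℬ.translate σ hσ).linkAt i j y hi hj)

/-- **The links of the translated atlas, on the original family of chart fans.**
[cite: Kato1994, (10.1)] -/
def translateLinks : Set (Fan.FamilyLink ℬ.n ℬ.chartFan) :=
  {ℓ | ∃ (i j : ℬ.ι × κ) (y : X) (hi : y ∈ ((ℬ.translate σ hσ).U i : X.Opens))
    (hj : y ∈ ((ℬ.translate σ hσ).U j : X.Opens)), ℓ = ℬ.translateLinkAt σ hσ i j y hi hj}

/-- `translateLinkAt i j y ∈ translateLinks`. [cite: Kato1994, (10.1)] -/
theorem linkAt_mem_translateLinks (i j : ℬ.ι × κ) (y : X)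
    (hi : y ∈ ((ℬ.translate σ hσ).U i : X.Opens)) (hj : y ∈ ((ℬ.translate σ hσ).U j : X.Opens)) :
    ℬ.translateLinkAt σ hσ i j y hi hj ∈ ℬ.translateLinks σ hσ :=
  ⟨i, j, y, hi, hj, rfl⟩

end LogRegularAtlas

end Literature.AlgebraicGeometry.Resolution

end
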